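import Mathlib
import Summits.NavierStokesRegularity.NavierStokesRegularity.Theorems.LandauTailLandauTailBlowupDivFreeTest

/-!
# The scaled solenoidal test field

Helper file for crux `LandauTailBlowup` (stmt-NavierStokesRegularity-1944), line `registered`,
registered stub `landauTail_exists_divFree_test_scaled` (A2, "the scaled solenoidal test field"):
for every `a ∈ ℝ³` there is a constant `K ≥ 0` such that for every radius `ρ > 0` there is a
`C^∞`, compactly supported, divergence-free field `φ : ℝ³ → ℝ³` with `tsupport φ ⊆ B(0, ρ)`,
`φ 0 = a`, `‖φ‖ ≤ K` and the sharp scaling `‖Dφ‖ ≤ K / ρ`, the constant `K` being independent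
of `ρ`.

Construction: take the unit-scale field `φ₁` of `landauTail_exists_divFree_test a` and put
`φ x = φ₁ (ρ⁻¹ • x)`; `K` is the maximum of `sup ‖φ₁‖` and `sup ‖Dφ₁‖` (both finite: continuous
with compact support).  Smoothness, support, solenoidality and the two bounds follow from the
chain rule `D(φ₁(ρ⁻¹ ·))(x) = ρ⁻¹ • Dφ₁(ρ⁻¹ x)` (Mathlib `fderiv_comp_smul`) and linearity of the
trace. [folklore]
-/

set_option linter.dupNamespace false

namespace Summit.NavierStokesRegularity.NavierStokesRegularity.Theorems

open Literature.Analysis.FluidPDE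

/-- **Solenoidality is dilation invariant**: `div (φ(c ·))(x) = c · (div φ)(c x)`, so a pointwise
divergence-free field composed with a homothety is divergence free (chain rule
`fderiv_comp_smul` and linearity of the trace). [folklore] -/
theorem landauTail_divergence_comp_smul (φ : EuclideanSpace ℝ (Fin 3) → EuclideanSpace ℝ (Fin 3))
    (c : ℝ) (x : EuclideanSpace ℝ (Fin 3)) :
    VectorCalculus.divergence (fun y => φ (c • y)) x = c * VectorCalculus.divergence φ (c • x) := by
  simp only [VectorCalculus.divergence]
  rw [fderiv_comp_smul, ContinuousLinearMap.toLinearMap_smul, map_smul, smul_eq_mul]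

/-- **The scaled solenoidal test field** (registered stub A2 of crux `LandauTailBlowup`,
stmt-NavierStokesRegularity-1944): for every `a ∈ ℝ³` there is `K ≥ 0` such that for every
`ρ > 0` some `φ ∈ C_c^∞(ℝ³; ℝ³)` has `tsupport φ ⊆ B(0, ρ)`, `div φ ≡ 0`, `φ 0 = a`, `‖φ x‖ ≤ K`
and `‖Dφ x‖ ≤ K / ρ` for all `x`.  Witness: `φ = φ₁(ρ⁻¹ ·)` with `φ₁` the unit-scale field of
`landauTail_exists_divFree_test`, `K = max (sup ‖φ₁‖) (sup ‖Dφ₁‖)`. [folklore] -/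
theorem landauTail_exists_divFree_test_scaled : ∀ a : EuclideanSpace ℝ (Fin 3), ∃ K : ℝ, 0 ≤ K ∧ ∀ ρ : ℝ, 0 < ρ → ∃ φ : EuclideanSpace ℝ (Fin 3) → EuclideanSpace ℝ (Fin 3), ContDiff ℝ (⊤ : ℕ∞) φ ∧ HasCompactSupport φ ∧ tsupport φ ⊆ Metric.ball (0 : EuclideanSpace ℝ (Fin 3)) ρ ∧ (∀ x, Literature.Analysis.FluidPDE.VectorCalculus.divergence φ x = 0) ∧ φ 0 = a ∧ (∀ x, ‖φ x‖ ≤ K) ∧ (∀ x, ‖fderiv ℝ φ x‖ ≤ K / ρ) := by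
  intro a
  obtain ⟨φ₁, hφs, hφc, hφt, hφd, hφ0⟩ := landauTail_exists_divFree_test a
  obtain ⟨C₁, hC₁⟩ := hφs.continuous.bounded_above_of_compact_support hφc
  obtain ⟨C₂, hC₂⟩ :=
    (hφs.continuous_fderiv (by simp)).bounded_above_of_compact_support (hφc.fderiv (𝕜 := ℝ))
  refine ⟨max C₁ C₂, ((norm_nonneg _).trans (hC₁ 0)).trans (le_max_left _ _), fun ρ hρ => ?_⟩
  have hρ' : 0 < ρ⁻¹ := inv_pos.2 hρ
  refine ⟨fun x => φ₁ (ρ⁻¹ • x), hφs.comp (contDiff_const_smul _), hφc.comp_smul hρ'.ne',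
    fun x hx => ?_, fun x => ?_, ?_, fun x => (hC₁ _).trans (le_max_left _ _), fun x => ?_⟩
  · -- support: `tsupport (φ₁ ∘ (ρ⁻¹ • ·)) ⊆ (ρ⁻¹ • ·)⁻¹' tsupport φ₁ ⊆ (ρ⁻¹ • ·)⁻¹' B(0, 1)`
    have h1 := hφt (tsupport_comp_subset_preimage φ₁
      (f := fun x : EuclideanSpace ℝ (Fin 3) => ρ⁻¹ • x) (continuous_const_smul ρ⁻¹) hx)
    rw [Metric.mem_ball, dist_zero_right] at h1 ⊢
    rw [norm_smul, Real.norm_eq_abs, abs_of_pos hρ'] at h1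
    calc ‖x‖ = ρ * (ρ⁻¹ * ‖x‖) := by field_simp
      _ < ρ * 1 := mul_lt_mul_of_pos_left h1 hρ
      _ = ρ := mul_one ρ
  · -- solenoidality
    rw [landauTail_divergence_comp_smul, hφd, mul_zero]
  · -- value at the origin
    simp only [smul_zero, hφ0]
  · -- gradient bound
    rw [fderiv_comp_smul, norm_smul, Real.norm_eq_abs, abs_of_pos hρ', div_eq_inv_mul]
    exact mul_le_mul_of_nonneg_left ((hC₂ _).trans (le_max_right _ _)) hρ'.le

end Summit.NavierStokesRegularity.NavierStokesRegularity.Theorems
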